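import Summits.QuantumFields.YangMills.Theorems.FluctuationComparisonRegPrIntLS2BetaWhitneyHatLiftCurvatureRelative
import Summits.QuantumFields.YangMills.Theorems.FluctuationComparisonRegPrIntLS2BetaRelativeFieldSquareSumPlaq
import Summits.QuantumFields.YangMills.Theorems.FluctuationComparisonRegPrIntLS2BetaHFlatOfFeeders
import HarnessLib

/-!
# S2β · the (D-stage) REL-TEL road — (F3)-rel ON THE TREE's PLAQUETTES, IN THE (H♭♭) FEEDERS DOOR's SHAPE:
# `‖dist1((Ṽ∂p)⁻¹·V∂p)‖_{ℓ²(Plaq P t)} ≤ 2√c·‖dist1((X̃∂p′)⁻¹·X∂p′)‖_{ℓ²(Plaq P (t+1))} + √c·√(768(d−1))·(s+s̃)·‖log X − log X̃‖_{ℓ²}`, `c = (L⁻¹)⁴·L^d`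

Cell `ym3-torus` (rung R3 = continuum `SU(2)` Yang–Mills on T³ — NOT d = 4, NOT infinite volume, NOT a mass gap, NOT Clay).  Width seat «width 12» `ym3-torus-px12`
(gen 24), FREE px helper on crux `stmt-QuantumFields-20520`; `--kind proof --supports … --as helper`, count-neutral, DEFINITION-FREE (0 `def`∕`instance`∕`notation`∕`sorry`).

WHAT IT IS FOR.  The (H♭♭) FEEDERS door ⧗`…S2BetaRelFlapOfFeeders.feedbackLetter_of_feeders` takes (F3)-rel in the shape
`hF3 : A^V_j ≤ C_F·A_{j+1} + φ_j·Λ_{j+1}` (`A^V_j = ‖dist1((plaqHol V₀_j q)⁻¹·plaqHol V_j q)‖_{ℓ²(Plaq)}`, `A_{j+1}` the coarse relative plaquettes on `Plaq`,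
`Λ_{j+1} = ‖log U′_{j+1} − log U′₀_{j+1}‖_{ℓ²}`).  ✓p821688 `…WhitneyHatLiftCurvatureRelative.sum_positions_dist1_rel_lift_sq_le` is stated over ORDERED POSITIONS
`(x; μ ≠ κ)` and squared; this file converts: §1 `dist1_rect_rel_one_one_comm`, ★`sum_positions_rel_sq_eq_two_mul_sum_plaq` (the relative twin of px13 g22's
✓`sum_positions_sq_eq_two_mul_sum_plaq`: positions = twice the plaquettes); §2 ★★`sum_plaq_dist1_rel_lift_sq_le` (squared, on `Plaq`), ★★★`sqrt_sum_plaq_dist1_rel_lift_le`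
(the door's `hF3` shape with `C_F = 2·√c`, `φ = √c·√(768(d−1))·(s+s̃)`, `c = (L⁻¹)⁴L^d` — at `d = 3`, `c = L⁻¹`).
HONEST SCOPE.  Reindexing and square roots over ✓p821688; nothing of Bałaban's analysis is asserted; (H♭♭)'s other feeders, (D-ax)∕(D♮), (F♮), GAP♯∘
(`stub_uniformFibreGapOrbit`), S2β, the five registered stubs (0∕5), crux 20520 and `YM3TorusSU2` are NOT proved; no registered stub is closed; the Yang–Mills mass
gap is NOT proved.
References: T. Bałaban, CMP **99** (1985) 75–102 [Balaban1985RegularSpaces] ((1.29) p.81); CMP **102** (1985) 277–309 [Balaban1985Variational] ((34) p.283);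
CMP **98** (1985) 17–51 [Balaban1985Averaging] ((9) p.19).
-/

set_option autoImplicit false

noncomputable section

namespace Summit.QuantumFields.YangMills.Theorems.FluctuationComparisonRegPrIntLS2BetaWhitneyHatLiftCurvatureRelativePlaq

open Finset
open scoped Real
open Literature.MathematicalPhysics.QuantumLattice (su2Quat)
open Literature.MathematicalPhysics.QuantumFieldTheory.Balaban1983to89
open B10Eq27TorusAxialLog (rel)
open B10Eq47AxialChi (rect rect_one_one)
open T4CubeChartGnomonic (SU2)
open T4HaarSU2ExpChart (expPoint)
open T4ExpWindowSmallField (logVec)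
open B11GaugeGlue (dist1_inv_mul_eq)
open Summit.QuantumFields.YangMills.Theorems.FluctuationComparisonRegPrIntLS2BetaRowTransportVariance (rect_swap)
open Summit.QuantumFields.YangMills.Theorems.FluctuationComparisonRegPrIntLS2BetaHFlatOfFeeders (sqrt_add_le_sqrt_add_sqrt_real)
open Summit.QuantumFields.YangMills.Theorems.FluctuationComparisonRegPrIntLS2BetaWhitneyHatLiftCurvatureRelative (sum_positions_dist1_rel_lift_sq_le)

variable {P : Params} {j t : ℕ} {G : Type*} [GaugeGroup G]

/-! ## §1 Positions versus plaquettes, relative -/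

/-- The relative `dist1` of a unit square does not see the order of its axes. [cite: Balaban1985Averaging, (9) p.19] -/
theorem dist1_rect_rel_one_one_comm (U U' : GaugeField P j G) (x : Site P j) (μ ν : Fin P.d) :
    dist1 ((rect U' x μ ν 1 1)⁻¹ * rect U x μ ν 1 1) = dist1 ((rect U' x ν μ 1 1)⁻¹ * rect U x ν μ 1 1) := by
  rw [rect_swap U x μ ν 1 1, rect_swap U' x μ ν 1 1, inv_inv, dist1_inv_mul_eq]

/-- ★ **Positions versus plaquettes, relative**: the sum of `dist1((U′∂q)⁻¹·U∂q)²` over plaquette positions `(x; μ ≠ κ)` is twice the sum over `Plaq P j`.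
[cite: Balaban1985Averaging, (9) p.19] -/
theorem sum_positions_rel_sq_eq_two_mul_sum_plaq (U U' : GaugeField P j G) :
    ∑ q ∈ (univ : Finset (Site P j × Fin P.d × Fin P.d)).filter (fun q => q.2.1 ≠ q.2.2),
        dist1 ((rect U' q.1 q.2.1 q.2.2 1 1)⁻¹ * rect U q.1 q.2.1 q.2.2 1 1) ^ 2 =
      2 * ∑ p : Plaq P j, dist1 ((GaugeField.plaqHol U' p)⁻¹ * GaugeField.plaqHol U p) ^ 2 := by
  classical
  set g : Site P j × Fin P.d × Fin P.d → ℝ := fun q => dist1 ((rect U' q.1 q.2.1 q.2.2 1 1)⁻¹ * rect U q.1 q.2.1 q.2.2 1 1) ^ 2 with hg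
  have hlt : ∑ q ∈ (univ : Finset (Site P j × Fin P.d × Fin P.d)).filter (fun q => q.2.1 < q.2.2), g q =
      ∑ p : Plaq P j, dist1 ((GaugeField.plaqHol U' p)⁻¹ * GaugeField.plaqHol U p) ^ 2 := by
    rw [sum_subtype ((univ : Finset (Site P j × Fin P.d × Fin P.d)).filter (fun q => q.2.1 < q.2.2))
      (p := fun q : Site P j × Fin P.d × Fin P.d => q.2.1 < q.2.2) (fun q => by simp)]
    refine Fintype.sum_equiv ⟨fun t => ⟨t.1.1, t.1.2.1, t.1.2.2, t.2⟩, fun p => ⟨(p.src, p.μ, p.ν), p.hμν⟩, fun _ => rfl, fun _ => rfl⟩ _ _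
      fun t => ?_
    show dist1 ((rect U' t.1.1 t.1.2.1 t.1.2.2 1 1)⁻¹ * rect U t.1.1 t.1.2.1 t.1.2.2 1 1) ^ 2 =
      dist1 ((GaugeField.plaqHol U' ⟨t.1.1, t.1.2.1, t.1.2.2, t.2⟩)⁻¹ * GaugeField.plaqHol U ⟨t.1.1, t.1.2.1, t.1.2.2, t.2⟩) ^ 2
    rw [rect_one_one U t.1.1 t.2, rect_one_one U' t.1.1 t.2]
  have hgt : ∑ q ∈ (univ : Finset (Site P j × Fin P.d × Fin P.d)).filter (fun q => q.2.2 < q.2.1), g q =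
      ∑ q ∈ (univ : Finset (Site P j × Fin P.d × Fin P.d)).filter (fun q => q.2.1 < q.2.2), g q := by
    refine sum_nbij' (fun q => (q.1, q.2.2, q.2.1)) (fun q => (q.1, q.2.2, q.2.1)) (fun q hq => ?_) (fun q hq => ?_)
      (fun q _ => rfl) (fun q _ => rfl) (fun q _ => ?_)
    · simp only [mem_filter, mem_univ, true_and] at hq ⊢; exact hq
    · simp only [mem_filter, mem_univ, true_and] at hq ⊢; exact hq
    · simp only [hg]; rw [dist1_rect_rel_one_one_comm]
  have hsplit : (univ : Finset (Site P j × Fin P.d × Fin P.d)).filter (fun q => q.2.1 ≠ q.2.2) =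
      (univ : Finset (Site P j × Fin P.d × Fin P.d)).filter (fun q => q.2.1 < q.2.2) ∪
        (univ : Finset (Site P j × Fin P.d × Fin P.d)).filter (fun q => q.2.2 < q.2.1) := by
    ext q
    simp only [mem_filter, mem_univ, true_and, mem_union]
    exact ⟨fun h => lt_or_gt_of_ne h, fun h => h.elim ne_of_lt ne_of_gt⟩
  have hdisj : Disjoint ((univ : Finset (Site P j × Fin P.d × Fin P.d)).filter (fun q => q.2.1 < q.2.2))
      ((univ : Finset (Site P j × Fin P.d × Fin P.d)).filter (fun q => q.2.2 < q.2.1)) := by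
    rw [disjoint_filter]
    intro q _ h1 h2
    exact lt_asymm h1 h2
  rw [hsplit, sum_union hdisj, hgt, hlt]
  ring

/-! ## §2 (F3)-rel on `Plaq`, squared and in the door's square-root shape -/

/-- ★★ **(F3)-rel ON THE TREE's PLAQUETTES, SQUARED**: for two coarse fields `X, X̃` with arcs `≤ s, s̃ ≤ 1∕4` and their hat lifts `V, Ṽ`,
`Σ_{p : Plaq P t} dist1((Ṽ∂p)⁻¹·V∂p)² ≤ (L⁻¹)⁴·L^d·(4·Σ_{p′ : Plaq P (t+1)} dist1((X̃∂p′)⁻¹·X∂p′)² + 768(d−1)(s+s̃)²·Σ_e ‖log X e − log X̃ e‖²)`.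
[cite: Balaban1985Variational, (34) p.283; Balaban1985RegularSpaces, (1.29) p.81] -/
theorem sum_plaq_dist1_rel_lift_sq_le (ht : t + 1 ≤ P.m + P.K) (w : PBond P t → PBond P (t + 1) → ℝ)
    (hw : ∀ b e, w b e = if e.dir = b.dir ∧ (b.src b.dir - emb e.src b.dir).val < P.L then
      ∏ ν ∈ Finset.univ.erase b.dir, max 0 (1 - ((rel (emb e.src) b.src ν).natAbs : ℝ) / P.L) else 0)
    (X X' : GaugeField P (t + 1) SU2) (V V' : GaugeField P t SU2)
    (hV : ∀ b, V b = expPoint (∑ e, w b e • ((P.L : ℝ)⁻¹ • logVec (su2Quat (X e)))))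
    (hV' : ∀ b, V' b = expPoint (∑ e, w b e • ((P.L : ℝ)⁻¹ • logVec (su2Quat (X' e)))))
    {s s' : ℝ} (hs : ∀ e, ‖logVec (su2Quat (X e))‖ ≤ s) (hs' : ∀ e, ‖logVec (su2Quat (X' e))‖ ≤ s') (hs4 : s ≤ 1 / 4) (hs4' : s' ≤ 1 / 4) :
    ∑ p : Plaq P t, dist1 ((GaugeField.plaqHol V' p)⁻¹ * GaugeField.plaqHol V p) ^ 2 ≤
      (((P.L : ℝ)⁻¹) ^ 2) ^ 2 * (P.L : ℝ) ^ P.d *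
        (4 * ∑ p : Plaq P (t + 1), dist1 ((GaugeField.plaqHol X' p)⁻¹ * GaugeField.plaqHol X p) ^ 2 +
          768 * ((P.d : ℝ) - 1) * (s + s') ^ 2 * ∑ e, ‖logVec (su2Quat (X e)) - logVec (su2Quat (X' e))‖ ^ 2) := by
  have h := sum_positions_dist1_rel_lift_sq_le ht w hw X X' V V' hV hV' hs hs' hs4 hs4'
  rw [sum_positions_rel_sq_eq_two_mul_sum_plaq V V', sum_positions_rel_sq_eq_two_mul_sum_plaq X X'] at h
  have hc : 0 ≤ (((P.L : ℝ)⁻¹) ^ 2) ^ 2 * (P.L : ℝ) ^ P.d := by positivity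
  nlinarith [h, hc]

/-- ★★★ **(F3)-rel IN THE (H♭♭) FEEDERS DOOR's SHAPE**: with `c = (L⁻¹)⁴·L^d`,
`√(Σ_p dist1((Ṽ∂p)⁻¹·V∂p)²) ≤ 2√c·√(Σ_{p′} dist1((X̃∂p′)⁻¹·X∂p′)²) + √c·√(768(d−1))·(s+s̃)·√(Σ_e ‖log X e − log X̃ e‖²)` — `hF3` with `C_F = 2√c`,
`φ = √c·√(768(d−1))·(s+s̃)`. [cite: Balaban1985Variational, (34) p.283; Balaban1985RegularSpaces, (1.29) p.81] -/
theorem sqrt_sum_plaq_dist1_rel_lift_le (ht : t + 1 ≤ P.m + P.K) (w : PBond P t → PBond P (t + 1) → ℝ)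
    (hw : ∀ b e, w b e = if e.dir = b.dir ∧ (b.src b.dir - emb e.src b.dir).val < P.L then
      ∏ ν ∈ Finset.univ.erase b.dir, max 0 (1 - ((rel (emb e.src) b.src ν).natAbs : ℝ) / P.L) else 0)
    (X X' : GaugeField P (t + 1) SU2) (V V' : GaugeField P t SU2)
    (hV : ∀ b, V b = expPoint (∑ e, w b e • ((P.L : ℝ)⁻¹ • logVec (su2Quat (X e)))))
    (hV' : ∀ b, V' b = expPoint (∑ e, w b e • ((P.L : ℝ)⁻¹ • logVec (su2Quat (X' e)))))
    {s s' : ℝ} (hs : ∀ e, ‖logVec (su2Quat (X e))‖ ≤ s) (hs' : ∀ e, ‖logVec (su2Quat (X' e))‖ ≤ s') (hs4 : s ≤ 1 / 4) (hs4' : s' ≤ 1 / 4) :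
    √(∑ p : Plaq P t, dist1 ((GaugeField.plaqHol V' p)⁻¹ * GaugeField.plaqHol V p) ^ 2) ≤
      2 * √((((P.L : ℝ)⁻¹) ^ 2) ^ 2 * (P.L : ℝ) ^ P.d) * √(∑ p : Plaq P (t + 1), dist1 ((GaugeField.plaqHol X' p)⁻¹ * GaugeField.plaqHol X p) ^ 2) +
        √((((P.L : ℝ)⁻¹) ^ 2) ^ 2 * (P.L : ℝ) ^ P.d) * √(768 * ((P.d : ℝ) - 1)) * (s + s') *
          √(∑ e, ‖logVec (su2Quat (X e)) - logVec (su2Quat (X' e))‖ ^ 2) := by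
  have h := sum_plaq_dist1_rel_lift_sq_le ht w hw X X' V V' hV hV' hs hs' hs4 hs4'
  set c : ℝ := (((P.L : ℝ)⁻¹) ^ 2) ^ 2 * (P.L : ℝ) ^ P.d with hc
  set A : ℝ := ∑ p : Plaq P (t + 1), dist1 ((GaugeField.plaqHol X' p)⁻¹ * GaugeField.plaqHol X p) ^ 2 with hA
  set Λ : ℝ := ∑ e, ‖logVec (su2Quat (X e)) - logVec (su2Quat (X' e))‖ ^ 2 with hΛ
  have hc0 : 0 ≤ c := by positivity
  have hA0 : 0 ≤ A := Finset.sum_nonneg fun _ _ => sq_nonneg _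
  have hΛ0 : 0 ≤ Λ := Finset.sum_nonneg fun _ _ => sq_nonneg _
  have hd1 : 0 ≤ (P.d : ℝ) - 1 := by have := P.hd; simp only [sub_nonneg, Nat.one_le_cast]; exact this
  have hss : 0 ≤ s + s' := by
    have e0 : PBond P (t + 1) := ⟨fun _ => 0, ⟨0, P.hd⟩⟩
    linarith [(norm_nonneg _).trans (hs e0), (norm_nonneg _).trans (hs' e0)]
  calc √(∑ p : Plaq P t, dist1 ((GaugeField.plaqHol V' p)⁻¹ * GaugeField.plaqHol V p) ^ 2)
      ≤ √(c * (4 * A + 768 * ((P.d : ℝ) - 1) * (s + s') ^ 2 * Λ)) := Real.sqrt_le_sqrt h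
    _ = √(c * (4 * A) + c * (768 * ((P.d : ℝ) - 1) * (s + s') ^ 2 * Λ)) := by rw [← mul_add]
    _ ≤ √(c * (4 * A)) + √(c * (768 * ((P.d : ℝ) - 1) * (s + s') ^ 2 * Λ)) := sqrt_add_le_sqrt_add_sqrt_real _ _
    _ = 2 * √c * √A + √c * √(768 * ((P.d : ℝ) - 1)) * (s + s') * √Λ := by
        rw [Real.sqrt_mul hc0, Real.sqrt_mul hc0, Real.sqrt_mul (by norm_num : (0:ℝ) ≤ 4),
          show √(4 : ℝ) = 2 from by rw [show (4 : ℝ) = 2 ^ 2 from by norm_num, Real.sqrt_sq (by norm_num)],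
          show 768 * ((P.d : ℝ) - 1) * (s + s') ^ 2 * Λ = (768 * ((P.d : ℝ) - 1)) * ((s + s') ^ 2 * Λ) from by ring,
          Real.sqrt_mul (by positivity : 0 ≤ 768 * ((P.d : ℝ) - 1)), Real.sqrt_mul (sq_nonneg (s + s')) Λ, Real.sqrt_sq hss]
        ring

end Summit.QuantumFields.YangMills.Theorems.FluctuationComparisonRegPrIntLS2BetaWhitneyHatLiftCurvatureRelativePlaq

end
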